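import Literature.MathematicalPhysics.QuantumFieldTheory.Balaban1983to89.B12AverageCorridor267
import Literature.MathematicalPhysics.QuantumFieldTheory.Balaban1983to89.BlockAveragingExpMeanLog
import Summits.QuantumFields.BalabanUV.T4Continuum.Support.ShellMeasureLinearizedRealStructure

/-!
# `T4Continuum.ShellMeasureAverageReal` — NE7c-S47: THE PRINTED BLOCK AVERAGE IS ⋆-EQUIVARIANT (REAL):
# `star (Q̃_V(B′)(c)) = Q̃_V(B′⋆)(c)` for (2.4) ∕ [B7] (15) over a UNITARY background, in the `mlog` regime
(cell `pub-balaban`, sub-cell `t4`, spine estimate NE7c (node U5b); NE7c ROUND-2 crew seat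
`b2b-balaban-t4-ne7c-formalise-leaf-09` gen 8; row **S47** «⋆-EQUIVARIANCE ∕ REALITY OF THE PRINTED AVERAGE» of the
owner table `t4/b2b-balaban-t4-ne7c-p1/LEAVES-NE7c-P1.md` v2.0 (owner gen 28's cut of WALL-NE7c-P1 §3 W-d, its ANALYTIC
HALF, for the printed average); imports `Literature.….B12AverageCorridor267` (the typed average (0.12)∕(15), `pert`,
`Qtilde`), `Literature.….BlockAveragingExpMeanLog` (`ExpMeanLog.mlog_eq_neg_of_mul_eq_one`, `norm_mlog_lt_log_two`,
hence `B7BlockAvgLog.mlog_exp`) and S40 `ShellMeasureLinearizedRealStructure` (the `Fix(κ)` dictionary) ONLY; [folklore]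
C⋆-algebra bookkeeping; ONE data `def` (`theta`, the group automorphism `u ↦ (u⋆)⁻¹` of `𝔸ˣ`), 0 `def … : Prop`,
0 sorry, 0 citations — page numbers LOCATE the printed formulas, which enter only through `B12AverageCorridor267`)

HONEST FRAMING.  Finite four-torus programme, rung (B)+1 only — NOT infinite volume, NOT a mass gap, NOT the Clay
problem, NOT summit progress.  NE7c (`T4IndicatorShell.ShellWeightBound`) is NOT PRINTED and NOT PROVED; «NE7c ⇐ the
named binders» (trigger c3).  Nothing of [Balaban 1983–89] is asserted: the block average `M_c(U)` of [B12] (0.12) ∕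
[B7] (15), the perturbed configuration `V′V`, `V′ = exp(iB′)` (p. 265) and `Q̃` of (2.4) enter ONLY as the tree's typed
objects `B12AverageCorridor267.avgM ∕ pert ∕ Qtilde` (corner cubes, abstract transporter family `𝒯`, printed
instance `gammaT`); what lands is ⋆-BOOKKEEPING in a C⋆-algebra: no estimate, no analyticity, no smallness is PROVED
here — the `mlog` regime (`‖W − 1‖ ≤ 1∕3` for the block loops and for the quotient `M_c(V′V)M_c(V)⁻¹`) is a DISPLAYED
hypothesis, to be discharged by row S49 (`ShellMeasureAverageAnalytic`, owner) ∕ `B12PlaquetteLoop267`.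
HONEST DEPENDENCY (cell, verbatim): continuum YM on T⁴ ⇐ BetaPertH ∧ nine spine estimates (0/9 proved);
BetaPertH ⇐ (D1) ∧ (D4) ∧ CAP+tail; G-an2-4 gates asym, D1 and NE2/3/4.

THE POINT.  On the (LR)_j road of record (S36 `ShellMeasureLinearizedRealForm` ∘ S40 `…RealStructure` ∘ S33) the
real form is `Fix(κ)` for involutive conjugate-linear isometries `κ_𝒴`, `κ_𝒳`, and `B12JacobianReal267`'s binders ask
the maps of print's substitution to be CONJUGATION-EQUIVARIANT (`hhop`, `hCt`).  For the PRINTED average the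
conjugation is `⋆` (componentwise on bond functions): `B′ = (1∕i) log V′` is HERMITIAN for unitary `V′` (p. 265), i.e.
`B′ ∈ Fix(⋆)`.  This file proves that `Q̃` COMMUTES WITH `⋆` over a unitary background:
* §1 the involutive group automorphism `θ u := (u⋆)⁻¹` of `𝔸ˣ` (`theta`): it fixes unitaries, `θ (e^a) = e^{−a⋆}`
  (Mathlib `NormedSpace.star_exp`), hence **`pert_star`**: `pert (B′⋆) V = θ ∘ pert B′ V` for unitary `V`
  (`(e^{iB})⋆ = e^{−iB⋆}`).
* §2 bond WORDS are θ-equivariant (θ is a monoid hom; `B12AverageCorridor267.map_lineR` BY NAME): `lineR`, `Ustr`, the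
  printed contours `gammaT` ([2] (1.7)), and the loops `W_x` (`loopW`) for any θ-equivariant transporter family.
* §3 in the `mlog` regime `‖W − 1‖ ≤ 1∕3`: `star (mlog W) = mlog (W⋆)` (`star_mlog` — the tree had it for matrices
  only, `BlockAveragingFederbush.mlog_star`), `mlog (θ W) = −(mlog W)⋆` (`mlog_theta`, by
  `BlockAveragingExpMeanLog.mlog_eq_neg_of_mul_eq_one`), hence **`avgM_theta`**: `M_c(θ ∘ U) = θ (M_c(U))` (the
  weights `L⁻ᵈ` are real).
* §4 **`star_Qtilde`**: `star (Q̃_V(B′)(c)) = Q̃_V(B′⋆)(c)` for unitary `V`, any θ-equivariant family (in particular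
  **`star_Qtilde_gammaT`** for [B7] (15) verbatim), under the displayed `mlog`-regime hypotheses; corollary
  **`Qtilde_selfAdjoint`**: Hermitian `B′` ⇒ Hermitian `Q̃_V(B′)(c)`.
* §5 the S40 dictionary: on a finite bond set the conjugation `starₗᵢ ℂ` (componentwise `⋆`, `Pi.cstarRing`) has
  `Fix = {B′ | ∀ b, (B′ b)⋆ = B′ b}` (`mem_realSub_pi_star_iff`) — the Hermitian bond functions, print's «𝐠-valued».
WHICH END ∕ BINDER.  Supplies, for the PRINTED average, the ⋆-equivariance input `Qt ∘ κ_𝒴 = κ_𝒳 ∘ Qt` of row S46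
(`realForm_chartData_of_Q`) ∕ the `hCt`-type binders of `B12JacobianReal267` on the (LR)_j road of record; re-sources
no SM-L binder, mints nothing (c2); what remains of W-d after S46–S49: the [dict] identification (node O).  NOTHING in
the countdown moves; NE7c NOT PROVED; spine PROVED 0/9.
-/

noncomputable section

open NormedSpace Finset

namespace Summit.QuantumFields.BalabanUV.T4Continuum.ShellMeasureAverageReal

open Literature.MathematicalPhysics.QuantumFieldTheory.Balaban1983to89
open Literature.MathematicalPhysics.QuantumLattice (ZdEdge blockSites)
open B7Eq61Linearization (lineR)
open B12HOperator267 (gammaT)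
open B12AverageCorridor267 (expU val_expU val_inv_expU avgM pert pert_apply Qtilde loopW loopW_def Ustr map_lineR)
open ExpMeanLog (mlog_eq_neg_of_mul_eq_one norm_mlog_lt_log_two)
open B7BlockAvgLog (mlog_exp)
open MatrixLog (mlog exp_mlog)
open ShellMeasureLinearizedRealStructure (realSub mem_realSub)

variable {d : ℕ}

/-! ## §1 The automorphism `θ u = (u⋆)⁻¹` of the unit group; `pert (B′⋆) V = θ ∘ pert B′ V` -/

section Theta

variable {𝔸 : Type*} [NormedRing 𝔸] [StarRing 𝔸]

/-- THE GROUP AUTOMORPHISM `θ u := (u⋆)⁻¹` of the unit group `𝔸ˣ` of a normed ⋆-algebra (a monoid hom: `⋆` is an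
anti-automorphism and inversion another one). [folklore] -/
def theta : 𝔸ˣ →* 𝔸ˣ where
  toFun u := (star u)⁻¹
  map_one' := by rw [star_one, inv_one]
  map_mul' u v := by rw [star_mul, mul_inv_rev]

/-- unfolding. [folklore] -/
theorem theta_apply (u : 𝔸ˣ) : theta u = (star u)⁻¹ := rfl

/-- the value of `θ u` in `𝔸` is `(u⁻¹)⋆`. [folklore] -/
theorem coe_theta (u : 𝔸ˣ) : ((theta u : 𝔸ˣ) : 𝔸) = star ((u⁻¹ : 𝔸ˣ) : 𝔸) := Units.coe_star_inv u

/-- the value of `(θ u)⁻¹` in `𝔸` is `u⋆`. [folklore] -/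
theorem coe_theta_inv (u : 𝔸ˣ) : (((theta u)⁻¹ : 𝔸ˣ) : 𝔸) = star (u : 𝔸) := by
  rw [theta_apply, inv_inv, Units.coe_star]

/-- `θ` is INVOLUTIVE. [folklore] -/
theorem theta_theta (u : 𝔸ˣ) : theta (theta u) = u := by
  rw [theta_apply, theta_apply, star_inv, inv_inv, star_star]

/-- `θ` FIXES UNITARIES: `u⋆u = 1 ⇒ (u⋆)⁻¹ = u`. [folklore] -/
theorem theta_eq_self_of_mem_unitary {u : 𝔸ˣ} (hu : (u : 𝔸) ∈ unitary 𝔸) : theta u = u :=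
  inv_eq_of_mul_eq_one_right (Units.ext (by
    rw [Units.val_mul, Units.coe_star, Units.val_one]; exact Unitary.star_mul_self_of_mem hu))

end Theta

/-! ### `θ` through the exponential and the perturbed configuration -/

section ThetaExp

variable {𝔸 : Type*} [NormedRing 𝔸] [NormedAlgebra ℂ 𝔸] [CompleteSpace 𝔸] [StarRing 𝔸] [CStarRing 𝔸]

/-- `θ (e^a) = e^{−a⋆}` (`(e^a)⋆ = e^{a⋆}`, Mathlib `NormedSpace.star_exp`). [folklore] -/
theorem theta_expU (a : 𝔸) : theta (expU a) = expU (-star a) :=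
  Units.ext (by rw [coe_theta, val_inv_expU, star_exp, star_neg, val_expU])

variable [StarModule ℂ 𝔸]

/-- **`pert (B′⋆) V = θ ∘ pert B′ V` FOR A UNITARY BACKGROUND**: `e^{iB⋆} V = ((e^{iB} V)⋆)⁻¹` when `V⋆ = V⁻¹`
(`(e^{iB})⋆ = e^{−iB⋆}` as `i⋆ = −i`). [folklore] -/
theorem pert_star {V : ZdEdge d → 𝔸ˣ} (hV : ∀ b, (V b : 𝔸) ∈ unitary 𝔸) (B' : ZdEdge d → 𝔸) :
    pert (fun b => star (B' b)) V = fun b => theta (pert B' V b) := by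
  funext b
  rw [pert_apply, pert_apply, map_mul, theta_eq_self_of_mem_unitary (hV b), theta_expU, star_smul,
    Complex.star_def, Complex.conj_I, neg_smul, neg_neg]

end ThetaExp

/-! ## §2 Bond words are `θ`-equivariant -/

section Words

variable {𝔸 : Type*} [NormedRing 𝔸] [StarRing 𝔸]

/-- straight transporters: `lineR (θ ∘ U) = θ (lineR U)` (`B12AverageCorridor267.map_lineR`). [folklore] -/
theorem theta_lineR (U : ZdEdge d → 𝔸ˣ) (x : Fin d → ℤ) (μ : Fin d) (n : ℕ) :
    lineR (fun b => theta (U b)) x μ n = theta (lineR U x μ n) :=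
  (map_lineR theta U x μ n).symm

/-- the coarse-bond transporter `U(c)`: `Ustr (θ ∘ U) c = θ (Ustr U c)`. [folklore] -/
theorem theta_Ustr (L : ℕ) (U : ZdEdge d → 𝔸ˣ) (c : ZdEdge d) :
    Ustr L (fun b => theta (U b)) c = theta (Ustr L U c) := by
  unfold Ustr
  exact (map_lineR theta U _ _ _).symm

/-- **the printed contours `Γ_{y,x}` of [2] (1.7) are θ-equivariant**: `gammaT L (θ ∘ U) x = θ (gammaT L U x)` (an
ordered product of straight transporters). [folklore] -/
theorem theta_gammaT (L : ℕ) (U : ZdEdge d → 𝔸ˣ) (x : Fin d → ℤ) :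
    gammaT L (fun b => theta (U b)) x = theta (gammaT L U x) := by
  unfold gammaT
  rw [map_list_prod, List.map_map]
  congr 1
  refine List.map_congr_left fun i _ => ?_
  simp only [Function.comp_apply, map_lineR]

/-- **the block loops are θ-equivariant**: `W_x(θ ∘ U) = θ (W_x(U))` for every transporter family `𝒯` that is itself
θ-equivariant (`h𝒯`; PROVED for `gammaT` above). [folklore] -/
theorem theta_loopW {L : ℕ} {𝒯 : (ZdEdge d → 𝔸ˣ) → (Fin d → ℤ) → 𝔸ˣ}
    (h𝒯 : ∀ (U : ZdEdge d → 𝔸ˣ) (x : Fin d → ℤ), 𝒯 (fun b => theta (U b)) x = theta (𝒯 U x))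
    (U : ZdEdge d → 𝔸ˣ) (c : ZdEdge d) (x : Fin d → ℤ) :
    loopW L 𝒯 (fun b => theta (U b)) c x = theta (loopW L 𝒯 U c x) := by
  rw [loopW_def, loopW_def, h𝒯, h𝒯, theta_lineR, theta_Ustr, ← map_inv, ← map_inv, ← map_mul, ← map_mul,
    ← map_mul]

end Words

/-! ## §3 `⋆` and `θ` through the series logarithm; the average is `θ`-equivariant -/

section Mlog

variable {𝔸 : Type*} [NormedRing 𝔸] [NormedAlgebra ℂ 𝔸] [CompleteSpace 𝔸] [StarRing 𝔸] [CStarRing 𝔸]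

/-- **`star (mlog W) = mlog (W⋆)`** in the `mlog` regime `‖W − 1‖ ≤ 1∕3` (the series (21) has real coefficients; proof
via `W⋆ = (e^{log W})⋆ = e^{(log W)⋆}` and `log ∘ exp = id` on `‖·‖ < ln 2`, `B7BlockAvgLog.mlog_exp`; the tree's
`BlockAveragingFederbush.mlog_star` is the matrix case). [folklore] -/
theorem star_mlog {W : 𝔸} (hW : ‖W - 1‖ ≤ 1 / 3) : star (mlog W) = mlog (star W) := by
  have hW1 : ‖W - 1‖ < 1 := lt_of_le_of_lt hW (by norm_num)
  have h1 : star W = exp (star (mlog W)) := by rw [← star_exp, exp_mlog hW1]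
  rw [h1, mlog_exp (by rw [norm_star]; exact norm_mlog_lt_log_two hW)]

/-- **`mlog (θ W) = −(mlog W)⋆`** in the `mlog` regime: `θ W = (W⋆)⁻¹`, `log` of an inverse is minus the `log`
(`BlockAveragingExpMeanLog.mlog_eq_neg_of_mul_eq_one`) and `log` commutes with `⋆` (`star_mlog`). [folklore] -/
theorem mlog_theta {W : 𝔸ˣ} (hW : ‖(W : 𝔸) - 1‖ ≤ 1 / 3) :
    mlog ((theta W : 𝔸ˣ) : 𝔸) = -star (mlog (W : 𝔸)) := by
  have hsW : ‖star (W : 𝔸) - 1‖ ≤ 1 / 3 := by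
    rw [show star (W : 𝔸) - 1 = star ((W : 𝔸) - 1) by rw [star_sub, star_one], norm_star]; exact hW
  have hmul : star (W : 𝔸) * ((theta W : 𝔸ˣ) : 𝔸) = 1 := by
    have h := congrArg (fun u : 𝔸ˣ => (u : 𝔸)) (mul_inv_cancel (star W))
    simpa only [theta_apply, Units.val_mul, Units.coe_star, Units.val_one] using h
  rw [mlog_eq_neg_of_mul_eq_one hmul hsW, ← star_mlog hW]

/-- the real weights `L⁻ᵈ` are ⋆-invariant. [folklore] -/
theorem star_weight (L n : ℕ) : star (((L : ℂ) ^ n)⁻¹) = ((L : ℂ) ^ n)⁻¹ := by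
  rw [star_inv₀, star_pow, star_natCast]

variable [StarModule ℂ 𝔸]

/-- **THE BLOCK AVERAGE IS θ-EQUIVARIANT**: `M_c(θ ∘ U) = θ (M_c(U))` for a θ-equivariant transporter family, in
the `mlog` regime of the block loops — `Σ_x L⁻ᵈ log W_x(θU) = −(Σ_x L⁻ᵈ log W_x(U))⋆` (`mlog_theta`, real weights),
`e^{−Y⋆} = θ(e^Y)` (`theta_expU`), `U(c)` a word (`theta_Ustr`). [folklore] -/
theorem avgM_theta {L : ℕ} {𝒯 : (ZdEdge d → 𝔸ˣ) → (Fin d → ℤ) → 𝔸ˣ}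
    (h𝒯 : ∀ (U : ZdEdge d → 𝔸ˣ) (x : Fin d → ℤ), 𝒯 (fun b => theta (U b)) x = theta (𝒯 U x))
    (U : ZdEdge d → 𝔸ˣ) (c : ZdEdge d)
    (hW : ∀ x ∈ blockSites L c.1, ‖((loopW L 𝒯 U c x : 𝔸ˣ) : 𝔸) - 1‖ ≤ 1 / 3) :
    avgM L 𝒯 (fun b => theta (U b)) c = theta (avgM L 𝒯 U c) := by
  unfold avgM
  rw [map_mul, theta_expU, theta_Ustr]
  congr 2
  rw [star_sum, ← Finset.sum_neg_distrib]
  refine Finset.sum_congr rfl fun x hx => ?_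
  rw [theta_loopW h𝒯, mlog_theta (hW x hx), smul_neg, star_smul, star_weight]

end Mlog

/-! ## §4 `⋆`-equivariance of `Q̃` over a unitary background -/

section Qtilde

variable {𝔸 : Type*} [NormedRing 𝔸] [NormedAlgebra ℂ 𝔸] [CompleteSpace 𝔸] [StarRing 𝔸] [CStarRing 𝔸]
  [StarModule ℂ 𝔸]

/-- **NE7c-S47 — THE PRINTED AVERAGE IS ⋆-EQUIVARIANT.**  In a C⋆-algebra, for a UNITARY background `V`
(`V b ∈ unitary 𝔸`), a θ-equivariant transporter family `𝒯` (e.g. the printed `gammaT`, `theta_gammaT`), a coarse bond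
`c` and a complex bond function `B′` such that the block loops of `V′V` and of `V` and the quotient
`Z = M_c(V′V)M_c(V)⁻¹` lie in the `mlog` regime `‖· − 1‖ ≤ 1∕3` (DISPLAYED hypotheses `hW`, `hW0`, `hZ`; row S49
discharges them on a sup-ball): `(Q̃_V(B′)(c))⋆ = Q̃_V(B′⋆)(c)`, where `B′⋆ := fun b => (B′ b)⋆`.  Chain: `pert_star`,
`avgM_theta` (for `V′V`, and for `V` using `θ ∘ V = V`), `θ` a hom, `mlog_theta` on `Z`, `(−i)⋆ = i`. [folklore] -/
theorem star_Qtilde {L : ℕ} {𝒯 : (ZdEdge d → 𝔸ˣ) → (Fin d → ℤ) → 𝔸ˣ}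
    (h𝒯 : ∀ (U : ZdEdge d → 𝔸ˣ) (x : Fin d → ℤ), 𝒯 (fun b => theta (U b)) x = theta (𝒯 U x))
    {V : ZdEdge d → 𝔸ˣ} (hV : ∀ b, (V b : 𝔸) ∈ unitary 𝔸) (B' : ZdEdge d → 𝔸) (c : ZdEdge d)
    (hW : ∀ x ∈ blockSites L c.1, ‖((loopW L 𝒯 (pert B' V) c x : 𝔸ˣ) : 𝔸) - 1‖ ≤ 1 / 3)
    (hW0 : ∀ x ∈ blockSites L c.1, ‖((loopW L 𝒯 V c x : 𝔸ˣ) : 𝔸) - 1‖ ≤ 1 / 3)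
    (hZ : ‖((avgM L 𝒯 (pert B' V) c * (avgM L 𝒯 V c)⁻¹ : 𝔸ˣ) : 𝔸) - 1‖ ≤ 1 / 3) :
    star (Qtilde L 𝒯 V B' c) = Qtilde L 𝒯 V (fun b => star (B' b)) c := by
  have hVθ : (fun b => theta (V b)) = V := funext fun b => theta_eq_self_of_mem_unitary (hV b)
  have hM0 : theta (avgM L 𝒯 V c) = avgM L 𝒯 V c := by rw [← avgM_theta h𝒯 V c hW0, hVθ]
  unfold Qtilde
  rw [pert_star hV, avgM_theta h𝒯 _ c hW]
  conv_rhs => rw [← hM0, ← map_inv, ← map_mul, mlog_theta hZ]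
  simp only [star_smul, star_neg, smul_neg, neg_smul, neg_neg, Complex.star_def, Complex.conj_I]

/-- **[B7] (15) VERBATIM**: the ⋆-equivariance for the printed contour family `gammaT` (θ-equivariant by
`theta_gammaT`). [folklore] -/
theorem star_Qtilde_gammaT {L : ℕ} {V : ZdEdge d → 𝔸ˣ} (hV : ∀ b, (V b : 𝔸) ∈ unitary 𝔸)
    (B' : ZdEdge d → 𝔸) (c : ZdEdge d)
    (hW : ∀ x ∈ blockSites L c.1, ‖((loopW L (gammaT L) (pert B' V) c x : 𝔸ˣ) : 𝔸) - 1‖ ≤ 1 / 3)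
    (hW0 : ∀ x ∈ blockSites L c.1, ‖((loopW L (gammaT L) V c x : 𝔸ˣ) : 𝔸) - 1‖ ≤ 1 / 3)
    (hZ : ‖((avgM L (gammaT L) (pert B' V) c * (avgM L (gammaT L) V c)⁻¹ : 𝔸ˣ) : 𝔸) - 1‖ ≤ 1 / 3) :
    star (Qtilde L (gammaT L) V B' c) = Qtilde L (gammaT L) V (fun b => star (B' b)) c :=
  star_Qtilde (theta_gammaT L) hV B' c hW hW0 hZ

/-- **HERMITIAN IN, HERMITIAN OUT**: for a Hermitian bond function `B′` (`(B′ b)⋆ = B′ b` — print's «B′ = (1∕i) log V′»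
for unitary `V′`, p. 265) the value `Q̃_V(B′)(c)` is Hermitian. [folklore] -/
theorem Qtilde_selfAdjoint {L : ℕ} {𝒯 : (ZdEdge d → 𝔸ˣ) → (Fin d → ℤ) → 𝔸ˣ}
    (h𝒯 : ∀ (U : ZdEdge d → 𝔸ˣ) (x : Fin d → ℤ), 𝒯 (fun b => theta (U b)) x = theta (𝒯 U x))
    {V : ZdEdge d → 𝔸ˣ} (hV : ∀ b, (V b : 𝔸) ∈ unitary 𝔸) {B' : ZdEdge d → 𝔸} (hB' : ∀ b, star (B' b) = B' b)
    (c : ZdEdge d)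
    (hW : ∀ x ∈ blockSites L c.1, ‖((loopW L 𝒯 (pert B' V) c x : 𝔸ˣ) : 𝔸) - 1‖ ≤ 1 / 3)
    (hW0 : ∀ x ∈ blockSites L c.1, ‖((loopW L 𝒯 V c x : 𝔸ˣ) : 𝔸) - 1‖ ≤ 1 / 3)
    (hZ : ‖((avgM L 𝒯 (pert B' V) c * (avgM L 𝒯 V c)⁻¹ : 𝔸ˣ) : 𝔸) - 1‖ ≤ 1 / 3) :
    star (Qtilde L 𝒯 V B' c) = Qtilde L 𝒯 V B' c := by
  have hB : (fun b => star (B' b)) = B' := funext hB'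
  rw [star_Qtilde h𝒯 hV B' c hW hW0 hZ, hB]

end Qtilde

/-! ## §5 The S40 dictionary: componentwise `⋆` on a finite bond set, `Fix = ` the Hermitian bond functions -/

section Dictionary

variable {𝔸 : Type*} [NormedRing 𝔸] [NormedAlgebra ℂ 𝔸] [StarRing 𝔸] [CStarRing 𝔸] [StarModule ℂ 𝔸]
  {s : Type*} [Fintype s]

/-- **THE REAL FORM OF THE BOND-FUNCTION SPACE IS THE HERMITIAN ONE**: for the componentwise conjugation
`starₗᵢ ℂ` on `s → 𝔸` (a finite bond set, sup norm; a conjugate-linear isometric involution, S40's `κ`), S40's real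
subspace `realSub (starₗᵢ ℂ)` is `{B′ | ∀ b, (B′ b)⋆ = B′ b}` — print's «𝐠-valued» `B′`. [folklore] -/
theorem mem_realSub_pi_star_iff (B : s → 𝔸) :
    B ∈ realSub (starₗᵢ ℂ : (s → 𝔸) ≃ₗᵢ⋆[ℂ] (s → 𝔸)) ↔ ∀ b, star (B b) = B b := by
  rw [mem_realSub, starₗᵢ_apply]
  exact ⟨fun h b => by rw [← Pi.star_apply B b, h], fun h => funext fun b => by rw [Pi.star_apply, h b]⟩

/-- the componentwise conjugation is involutive (S40's `hκ`). [folklore] -/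
theorem pi_star_involutive (B : s → 𝔸) :
    (starₗᵢ ℂ : (s → 𝔸) ≃ₗᵢ⋆[ℂ] (s → 𝔸)) ((starₗᵢ ℂ : (s → 𝔸) ≃ₗᵢ⋆[ℂ] (s → 𝔸)) B) = B := by
  rw [starₗᵢ_apply, starₗᵢ_apply, star_star]

/-- restriction of a bond function to a finite bond set commutes with `⋆` — so `star_Qtilde`'s `fun b => star (B′ b)`
is S40's `κ_𝒴 := starₗᵢ ℂ` on any finite window of bonds through which `B′` is read. [folklore] -/
theorem restrict_star (B' : ZdEdge d → 𝔸) (ι : s → ZdEdge d) :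
    (fun i => (fun b => star (B' b)) (ι i)) = (starₗᵢ ℂ : (s → 𝔸) ≃ₗᵢ⋆[ℂ] (s → 𝔸)) (fun i => B' (ι i)) := by
  rw [starₗᵢ_apply]
  rfl

end Dictionary

end Summit.QuantumFields.BalabanUV.T4Continuum.ShellMeasureAverageReal

end
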